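import Summits.QuantumFields.YangMills.Theorems.PencilRigidityDiagonalMirrorRPRStubRpClosureLattice
import Literature.MathematicalPhysics.QuantumFieldTheory.LatticeGaugeProofs

/-!
# Crux `DiagonalMirrorRPR`, line `kms-variance-lukewarm-descent`: the standard Wilson torus `(ℤ/Nℤ)⁴` IS the unsheared
# box torus `(N, N, N)` — expectations under `wilsonMeasure` are `texp … false`

Bridge from the statement's torus (`wilsonMeasure ρ β` on `GaugeConfig 4 N G`, sites `Fin 4 → ZMod N`, action
`Σ_p (N_c − Re tr ρ(U_p))`) to the box-torus calculus of the line (`TConfig N N N G`, sites `ZMod N × ZMod N × ZMod N × ZMod N`,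
weight `exp(β Σ_x Σ_{i<j} Re tr ρ(U_p))`): the site/edge relabelling `boxSite`/`boxEdge`, the configuration equivalence
`boxConfigEquiv` (product Haar preserved), `wilsonAction ∘ boxConfigEquiv = N_c·#plaquettes − taction`, and
**`∫ F d(wilsonMeasure) = Re texp ρ β false (F ∘ boxConfigEquiv)`** (the constant `exp(−β N_c #plaquettes)` cancels).
-/

set_option autoImplicit false

noncomputable section

open MeasureTheory
open Literature.MathematicalPhysics.QuantumLattice Literature.MathematicalPhysics.QuantumFieldTheory

namespace Summit.QuantumFields.YangMills.Cruxes.DiagonalMirrorRPR.KmsVarianceLukewarmDescent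

open ParityBridgeColdTraces ParityBridgeColdTraces.RpClosure

section Bridge

variable {N : ℕ}

/-- The site relabelling `(Fin 4 → ZMod N) ≃ ZMod N × ZMod N × ZMod N × ZMod N`. -/
def boxSite : Literature.MathematicalPhysics.QuantumFieldTheory.Site 4 N ≃ TSite N N N where
  toFun x := (x 0, x 1, x 2, x 3)
  invFun y := ![y.1, y.2.1, y.2.2.1, y.2.2.2]
  left_inv x := by funext i; fin_cases i <;> rfl
  right_inv y := by obtain ⟨a, b, c, d⟩ := y; rfl

/-- The site relabelling is additive. -/
theorem boxSite_add (x y : Literature.MathematicalPhysics.QuantumFieldTheory.Site 4 N) :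
    boxSite (x + y) = boxSite x + boxSite y := rfl

/-- The site relabelling maps the unit steps to the box-torus steps (unsheared). -/
theorem boxSite_single (i : Fin 4) :
    boxSite (Pi.single i (1 : ZMod N) : Literature.MathematicalPhysics.QuantumFieldTheory.Site 4 N) =
      (tstep false i : TSite N N N) := by
  fin_cases i <;> simp [boxSite, tstep]

/-- The induced relabelling of positively oriented edges. -/
def boxEdge : Literature.MathematicalPhysics.QuantumFieldTheory.Edge 4 N ≃ TEdge N N N :=
  Equiv.prodCongr boxSite (Equiv.refl (Fin 4))

variable {G : Type}

/-- Transport of a box configuration to the standard torus. -/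
def boxConfig (V : TConfig N N N G) : GaugeConfig 4 N G := fun e => V (boxEdge e)

section Alg

variable [Group G]

/-- Plaquette holonomies agree under the transport. -/
theorem plaquetteHolonomy_boxConfig (V : TConfig N N N G)
    (x : Literature.MathematicalPhysics.QuantumFieldTheory.Site 4 N) (i j : Fin 4) :
    plaquetteHolonomy (boxConfig V) x i j = tplaq false V (boxSite x) i j := by
  simp only [plaquetteHolonomy, boxConfig, boxEdge, Equiv.prodCongr_apply, Prod.map_apply, Equiv.coe_refl, id_eq,
    Literature.MathematicalPhysics.QuantumFieldTheory.Site.shift, boxSite_add, boxSite_single, tplaq]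

/-- The sum over the plaquettes of the standard torus is the ordered-pair sum over its sites. -/
theorem sum_plaquette_eq [NeZero N] (g : Literature.MathematicalPhysics.QuantumFieldTheory.Site 4 N → Fin 4 → Fin 4 → ℝ) :
    ∑ p : Plaquette 4 N, g p.1 p.2.1.1 p.2.1.2 =
      ∑ x : Literature.MathematicalPhysics.QuantumFieldTheory.Site 4 N, ∑ i : Fin 4, ∑ j : Fin 4,
        if i < j then g x i j else 0 := by
  rw [Fintype.sum_prod_type]
  refine Finset.sum_congr rfl fun x _ => ?_
  have h : ∑ q : {q : Fin 4 × Fin 4 // q.1 < q.2}, g x q.1.1 q.1.2 =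
      ∑ q : Fin 4 × Fin 4, if q.1 < q.2 then g x q.1 q.2 else 0 := by
    rw [← Finset.sum_filter, ← Finset.sum_subtype_eq_sum_filter, Finset.subtype_univ]
  rw [h, Fintype.sum_prod_type]

variable {Nc : ℕ} (ρ : G →* Matrix (Fin Nc) (Fin Nc) ℂ)

/-- **The Wilson action transported**: `S(boxConfig V) = N_c · #plaquettes − taction ρ false V`. -/
theorem wilsonAction_boxConfig [NeZero N] (V : TConfig N N N G) :
    wilsonAction ρ (boxConfig V) = (Nc : ℝ) * Fintype.card (Plaquette 4 N) - taction ρ false V := by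
  unfold wilsonAction
  rw [Finset.sum_sub_distrib, Finset.sum_const, Finset.card_univ, nsmul_eq_mul, mul_comm]
  congr 1
  rw [sum_plaquette_eq (fun x i j => (ρ (plaquetteHolonomy (boxConfig V) x i j)).trace.re)]
  unfold taction
  rw [← boxSite.sum_comp]
  simp only [plaquetteHolonomy_boxConfig]

end Alg

section Meas

variable [MeasurableSpace G]

/-- The edge relabelling as a measurable equivalence of configuration spaces. -/
def boxConfigEquiv : TConfig N N N G ≃ᵐ GaugeConfig 4 N G :=
  MeasurableEquiv.piCongrLeft (fun _ : Literature.MathematicalPhysics.QuantumFieldTheory.Edge 4 N => G)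
    (boxEdge (N := N)).symm

/-- The measurable equivalence is the transport. -/
theorem boxConfigEquiv_apply (V : TConfig N N N G) : boxConfigEquiv V = boxConfig V := by
  funext e
  simp only [boxConfigEquiv, MeasurableEquiv.coe_piCongrLeft, Equiv.piCongrLeft_apply_eq_cast, cast_eq,
    Equiv.symm_symm, boxConfig]

variable [Group G] [TopologicalSpace G] [IsTopologicalGroup G] [CompactSpace G] [BorelSpace G]

/-- The transport preserves product Haar measure. -/
theorem measurePreserving_boxConfigEquiv [NeZero N] :
    MeasurePreserving (boxConfigEquiv : TConfig N N N G ≃ᵐ GaugeConfig 4 N G) (thaar N N N)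
      (Measure.pi fun _ : Literature.MathematicalPhysics.QuantumFieldTheory.Edge 4 N => haarProbability G) := by
  unfold thaar boxConfigEquiv
  exact measurePreserving_piCongrLeft
    (μ := fun _ : Literature.MathematicalPhysics.QuantumFieldTheory.Edge 4 N => haarProbability G) (boxEdge (N := N)).symm

end Meas


section Integral

variable [MeasurableSpace G] [Group G] [TopologicalSpace G] [IsTopologicalGroup G] [CompactSpace G] [BorelSpace G]
  [SecondCountableTopology G] {Nc : ℕ} (ρ : G →* Matrix (Fin Nc) (Fin Nc) ℂ) (β : ℝ)

/-- **Wilson expectations as Gibbs averages against product Haar measure** (the normalising `partitionFunction` is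
finite and positive for continuous `ρ`). -/
theorem integral_wilsonMeasure_eq_div' [NeZero N] (hρ : Continuous ρ) (F : GaugeConfig 4 N G → ℝ) :
    ∫ U, F U ∂(wilsonMeasure ρ β) =
      (∫ U, F U * Real.exp (-β * wilsonAction ρ U)
          ∂(Measure.pi fun _ : Literature.MathematicalPhysics.QuantumFieldTheory.Edge 4 N => haarProbability G)) /
        ∫ U, Real.exp (-β * wilsonAction ρ U)
          ∂(Measure.pi fun _ : Literature.MathematicalPhysics.QuantumFieldTheory.Edge 4 N => haarProbability G) := by
  -- adapted from `integral_wilsonMeasure_eq_div` (Theorems/TunedSequenceExists/Negative/Freezing)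
  have hw : Measurable fun U : GaugeConfig 4 N G => ENNReal.ofReal (Real.exp (-β * wilsonAction ρ U)) :=
    (Real.measurable_exp.comp ((measurable_wilsonAction ρ hρ).const_mul _)).ennreal_ofReal
  have hZ : partitionFunction (d := 4) (L := N) ρ β =
      ∫⁻ U, ENNReal.ofReal (Real.exp (-β * wilsonAction ρ U))
        ∂(Measure.pi fun _ : Literature.MathematicalPhysics.QuantumFieldTheory.Edge 4 N => haarProbability G) := by
    simp only [partitionFunction, wilsonWeight, withDensity_apply _ MeasurableSet.univ, Measure.restrict_univ]
  have hZreal : (partitionFunction (d := 4) (L := N) ρ β).toReal =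
      ∫ U, Real.exp (-β * wilsonAction ρ U)
        ∂(Measure.pi fun _ : Literature.MathematicalPhysics.QuantumFieldTheory.Edge 4 N => haarProbability G) := by
    rw [hZ, integral_eq_lintegral_of_nonneg_ae (ae_of_all _ fun U => (Real.exp_pos _).le)]
    exact (Real.measurable_exp.comp ((measurable_wilsonAction ρ hρ).const_mul _)).aestronglyMeasurable
  unfold wilsonMeasure
  rw [integral_smul_measure, wilsonWeight, integral_withDensity_eq_integral_toReal_smul hw
    (ae_of_all _ fun _ => ENNReal.ofReal_lt_top), ENNReal.toReal_inv, hZreal, smul_eq_mul, inv_mul_eq_div]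
  congr 1
  refine integral_congr_ae (ae_of_all _ fun U => ?_)
  beta_reduce
  rw [ENNReal.toReal_ofReal (Real.exp_pos _).le, smul_eq_mul, mul_comm]

omit [MeasurableSpace G] [TopologicalSpace G] [IsTopologicalGroup G] [CompactSpace G] [BorelSpace G]
  [SecondCountableTopology G] in
/-- The Boltzmann factor of the standard torus on a transported configuration is a CONSTANT multiple of the box weight:
`exp(−β S(boxConfig V)) = exp(−β N_c #plaquettes) · tweight ρ β false V`. -/
theorem exp_neg_mul_wilsonAction_boxConfig [NeZero N] (V : TConfig N N N G) :
    Real.exp (-β * wilsonAction ρ (boxConfig V)) =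
      Real.exp (-β * ((Nc : ℝ) * Fintype.card (Plaquette 4 N))) * tweight ρ β false V := by
  rw [wilsonAction_boxConfig, tweight, ← Real.exp_add]
  congr 1
  ring

/-- **The statement's torus is the box torus `(N, N, N)`**: for a real observable `F` of the standard Wilson torus,
`∫ F d(wilsonMeasure ρ β) = Re ⟨F ∘ boxConfig⟩` with `⟨·⟩ = texp ρ β false` on `TConfig N N N G`. -/
theorem integral_wilsonMeasure_eq_texp [NeZero N] (hρ : Continuous ρ) (F : GaugeConfig 4 N G → ℝ) :
    ∫ U, F U ∂(wilsonMeasure ρ β) =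
      (texp ρ β false fun V : TConfig N N N G => ((F (boxConfig V) : ℝ) : ℂ)).re := by
  rw [integral_wilsonMeasure_eq_div' ρ β hρ, texp_ofReal, Complex.ofReal_re]
  have hmp := measurePreserving_boxConfigEquiv (N := N) (G := G)
  rw [← hmp.integral_comp', ← hmp.integral_comp']
  simp only [boxConfigEquiv_apply, exp_neg_mul_wilsonAction_boxConfig ρ β]
  set c : ℝ := Real.exp (-β * ((Nc : ℝ) * Fintype.card (Plaquette 4 N))) with hc
  have hc0 : c ≠ 0 := (Real.exp_pos _).ne'
  have h1 : ∫ V : TConfig N N N G, F (boxConfig V) * (c * tweight ρ β false V) ∂(thaar N N N) =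
      c * ∫ V : TConfig N N N G, F (boxConfig V) * tweight ρ β false V ∂(thaar N N N) := by
    rw [← integral_const_mul]
    refine integral_congr_ae (ae_of_all _ fun V => ?_)
    ring
  have h2 : ∫ V : TConfig N N N G, c * tweight ρ β false V ∂(thaar N N N) = c * tZ ρ N N N β false := by
    rw [integral_const_mul, tZ]
  rw [h1, h2, mul_div_mul_left _ _ hc0]

/-- **`latticeSchwinger` on the box torus**: the joint lattice `n`-point function of the scheme at step `k` is the box-torus
expectation `texp ρ (β_k) false` on `TConfig N_k N_k N_k` of the same product of smeared fields, transported by `boxConfig`. -/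
theorem latticeSchwinger_eq_texp (hρ : Continuous ρ) {ι : Type} (sch : SpeciesScheme ι) (obs : ι → LGConfig 4 G → ℝ)
    (k n : ℕ) (σ : Fin n → ι) (f : Fin n → SchwartzMap (EuclideanSpace ℝ (Fin 4)) ℝ) :
    latticeSchwinger ρ sch obs k n σ f =
      (texp ρ (sch.β k) false fun V : TConfig (sch.side k) (sch.side k) (sch.side k) G =>
        ((∏ i, smearedLatticeField (obs (σ i)) (Literature.Probability.LatticeModels.box 4 (sch.L k)) (sch.a k)
            (sch.c (σ i) k) (sch.m (σ i) k) (f i) (torusLift (sch.side k) (boxConfig V)) : ℝ) : ℂ)).re := by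
  unfold latticeSchwinger
  exact integral_wilsonMeasure_eq_texp ρ (sch.β k) hρ _

/-- **Registered sub-goal `stub_latticeSchwinger_texp` of `stub_secondMomentLever`** (torus bridge: the statement's
Wilson torus is the unsheared box torus `(N_k, N_k, N_k)` of the slicing calculus). -/
theorem stub_latticeSchwinger_texp :
    ∀ {G : Type} [MeasurableSpace G] [Group G] [TopologicalSpace G] [IsTopologicalGroup G] [CompactSpace G] [BorelSpace G]
      [SecondCountableTopology G] {Nc : ℕ} (ρ : G →* Matrix (Fin Nc) (Fin Nc) ℂ), Continuous ρ →
      ∀ {ι : Type} (sch : SpeciesScheme ι) (obs : ι → LGConfig 4 G → ℝ) (k n : ℕ) (σ : Fin n → ι)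
        (f : Fin n → SchwartzMap (EuclideanSpace ℝ (Fin 4)) ℝ),
        latticeSchwinger ρ sch obs k n σ f =
          (texp ρ (sch.β k) false fun V : TConfig (sch.side k) (sch.side k) (sch.side k) G =>
            ((∏ i, smearedLatticeField (obs (σ i)) (Literature.Probability.LatticeModels.box 4 (sch.L k)) (sch.a k)
                (sch.c (σ i) k) (sch.m (σ i) k) (f i) (torusLift (sch.side k) (boxConfig V)) : ℝ) : ℂ)).re := by
  intro G _ _ _ _ _ _ _ Nc ρ hρ ι sch obs k n σ f
  exact latticeSchwinger_eq_texp ρ hρ sch obs k n σ f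

end Integral

end Bridge

end Summit.QuantumFields.YangMills.Cruxes.DiagonalMirrorRPR.KmsVarianceLukewarmDescent

end
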